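import Literature.IUT.HodgeTheaters.BadLocalGroupDatumOfDoubleUnderline
import Literature.AnabelianGeometry.EtaleTheta.SettingModelTateDoubleUnderline
import Literature.AnabelianGeometry.EtaleTheta.SettingModelTateThetaTopology
import HarnessLib

/-!
# [IUTchI] Ex. 3.2's group datum at the [EtTh] §1 double-underline curve: the three interface laws from the
# two PRINTED parameters only, and binder-free at the Tate datum of record `ThetaSetting.modelχq p i j`

S. Mochizuki, *Inter-universal Teichmüller Theory I*, Example 3.2 (i) p. 70 («`D_v := B^temp(X̲̲_v)⁰` … the natural
functor `D_v → D⊢_v`»), (ii) p. 70 («the tempered covering `Ÿ_v → X̲̲_v`»), (v) p. 72 («the base field of `Ÿ_v` is equal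
to `K_v`») [cite: Mochizuki2012, I Ex 3.2 (i)(v) pp.70-72] (D-0012 claim key, status disputed; nothing of the series is
asserted); S. Mochizuki, *Semi-graphs of anabelioids* [SemiAnbd], Example 3.10 p. 43 («`Π^temp_{X_K}` is a tempered
topological group»), §6 p. 69 (the augmentation `Π^tp_X ↠ G_K`) [cite: MochizukiSemiAnbd2006, Ex 3.10 p.43]; [IUTchI]
Remark 2.5.3 (i) p. 52 («Galois-countable») [cite: Mochizuki2012, I Rmk 2.5.3 (i) p.52]; [EtTh] Def. 2.5 p. 39 («`K = K̈`»)
[cite: MochizukiEtTh2009, Def 2.5 p.39].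

Cell abc-iut, seat abc-iut-w6-d012 (gen 6), abc-iut-L5-lead (gen 8) L5 ROWS #5 row R20 «EX32-M2-LAWS-AT-ETTH-DATUM».
PROOF-ONLY companion of abc-iut-L2-t7's junction `BadLocalGroupDatum.ofDoubleUnderline` (p448934; consumed BY NAME, nothing
restated or edited; abc-iut-L5-t2's `BadLocalGroupDatum` interface untouched).  CENSUS of the three interface laws of
`BadLocalGroupDatum G ↥C.Huu` at the genuine [EtTh] §1 group datum (`Π_v := Π^tp_{X̲̲} = C.Huu`, `aug := ι ∘ augGK|`,
`Π_Ÿ := Π^tp_Ÿ ∩ Π^tp_{X̲̲}`), binder by binder: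
* law (a) «`aug` continuous» — NO binder (p448934 `continuous_augOfDoubleUnderline`);
* law (b) «`aug` open» — p448934 takes abc-iut-L3's whole parameter bundle `d : GroupLevelData` (six fields: `galEquiv`,
  `isTempered`, `isTempered_ker`, `isSlimGroup`, `isSlimGroup_ker`, `secondCountableTopology`), but its proof
  (`TemperedCurve.isOpenMap_aug_of_groupLevelData` ← `isOpenMap_aug_of_isTempered`, [SemiAnbd] Thm. 6.8 sub-DAG) READS ONLY
  «`Π^tp_X` tempered» and «`Π^tp_X` Galois-countable (first countable)»; the four slimness / kernel-temperedness /
  `galEquiv` fields are IDLE for this law — `isOpenMap_augOfDoubleUnderline_of_isTempered` below displays exactly the two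
  printed parameters ([SemiAnbd] Ex. 3.10, [IUTchI] Rmk. 2.5.3 (i));
* law (c) «`aug(Π_Ÿ) = G`» — the double-underline LAW `map_aug_Ydduu` (a FIELD of abc-iut-L2-t8's `E.DoubleUnderline l`,
  datum-internal) read through `ι`; the binder `hS : Sec2Hyps` («`K = K̈`») enters only to make `Π^tp_Ÿ` OPEN
  (`isOpen_GtpYdd`), i.e. to type `Π_Ÿ` as an `OpenSubgroup`.
RESULT: (1) `exists_badLocalGroupDatum_of_isTempered` / `nonempty_ofDoubleUnderline_of_isTempered` — the Ex. 3.2 group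
datum over EVERY [EtTh] §1 setting from {`IsTempered Π^tp_X`, `FirstCountableTopology Π^tp_X`, `Sec2Hyps`} + the data
`C`, `ι` (strictly fewer binders than p448934's `nonempty_ofDoubleUnderline`); (2) AT THE TATE DATUM OF RECORD
`ThetaSetting.modelχq p i j hj` (abc-iut-L2's semi-synthetic stage-2 model; `K = ℚ_p`) all three laws hold with NO
hypothesis binder at all, for every étale theta datum `E`, every double-underline curve `C : E.DoubleUnderline l` and
every identification `ι` — `isTempered_piTemp_modelχq`, `secondCountableTopology_piTemp_modelχq` (abc-iut-L2/L3,
SettingModelTateThetaTopology) and `ThetaSetting.modelχq_sec2Hyps` (SettingModelTateDoubleUnderline) consumed BY NAME: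
`exists_badLocalGroupDatum_modelχq`, `nonempty_ofDoubleUnderline_modelχq`.
Residual of record for a GENUINE (scheme-theoretic) tempered curve: none beyond the two printed parameters — no
`ThetaSetting` is constructed from an actual Tate curve in the tree (FOUNDATIONS row), so «genuine» = the [EtTh] §1 setting
datum itself, where «tempered» / «Galois-countable» are the printed properties [SemiAnbd] Ex. 3.10 / [IUTchI] Rmk. 2.5.3 (i)
(abc-iut-L3-lead ruling η′: parameters, never named facts).  HONEST FRAMING: [EtTh]/[SemiAnbd] are refereed inputs consumed
by name; [IUTchI] is disputed and nothing of it is asserted; a semi-synthetic model instance is binder-discharge evidence,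
not print's universal statement; no side taken on [IUTchIII] Cor. 3.12; typed ≠ inhabited ≠ discharged.
-/

noncomputable section

namespace Literature.IUT.HodgeTheaters

open Literature.AnabelianGeometry.SemiGraphs Literature.AnabelianGeometry.EtaleTheta _root_.Topology

namespace BadLocalGroupDatum

variable {p : ℕ} [Fact p.Prime] {D : ThetaSetting p} {E : D.EtaleThetaData} {l : ℕ}
variable {G : Type} [Group G] [TopologicalSpace G]

/-! ### Law (b) from the two printed parameters only -/

/-- **Law (b) «the augmentation `Π^tp_{X̲̲} → G` is OPEN» from «`Π^tp_X` tempered» + «`Π^tp_X` first countable» ALONE**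
(the other four fields of abc-iut-L3's `GroupLevelData` are idle for this law): `augGK` is open by abc-iut-L3's
`TemperedCurve.isOpenMap_augGK_of_isTempered` ([SemiAnbd] Thm. 6.8 sub-DAG), `Π^tp_{X̲̲} = C.Huu` is open in `Π^tp_X`, `ι` is a
homeomorphism. [cite: MochizukiSemiAnbd2006, §6 p.69] -/
theorem isOpenMap_augOfDoubleUnderline_of_isTempered (hX : IsTempered D.PiTemp) [FirstCountableTopology D.PiTemp]
    (ι : ↥D.GK ≃ₜ* G) (C : E.DoubleUnderline l) : IsOpenMap (augOfDoubleUnderline ι C) :=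
  (ι.toHomeomorph.isOpenMap.comp (D.toTemperedCurve.isOpenMap_augGK_of_isTempered hX)).comp
    C.isOpen_Huu.isOpenMap_subtype_val

/-- **The [IUTchI] Ex. 3.2 group datum over the [EtTh] §1 double-underline curve from the printed parameters only**:
given «`Π^tp_X` tempered», «`Π^tp_X` first countable», `K = K̈` (`Sec2Hyps`), a double-underline curve `C` and an
identification `ι : G_K ≃ₜ* G`, there is a `BadLocalGroupDatum G ↥C.Huu` whose augmentation IS `ι ∘ augGK|_{Π^tp_{X̲̲}}` and
whose covering subgroup IS `Π^tp_{Ÿ̲̲} = Π^tp_Ÿ ∩ Π^tp_{X̲̲}` (the same data as abc-iut-L2-t7's `ofDoubleUnderline`, with the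
idle bundle fields dropped). [cite: Mochizuki2012, I Ex 3.2 (i)(v) pp.70-72] -/
theorem exists_badLocalGroupDatum_of_isTempered (hX : IsTempered D.PiTemp) [FirstCountableTopology D.PiTemp]
    (hS : D.Sec2Hyps) (C : E.DoubleUnderline l) (ι : ↥D.GK ≃ₜ* G) :
    ∃ T : BadLocalGroupDatum G ↥C.Huu, T.aug = augOfDoubleUnderline ι C ∧ T.Y = Ydduu hS C :=
  ⟨{ aug := augOfDoubleUnderline ι C
     continuous_aug := continuous_augOfDoubleUnderline ι C
     isOpenMap_aug := isOpenMap_augOfDoubleUnderline_of_isTempered hX ι C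
     Y := Ydduu hS C
     map_Y := map_augOfDoubleUnderline_Ydduu hS ι C }, rfl, rfl⟩

/-- **Existence form (census) from the printed parameters only**: the [IUTchI] Ex. 3.2 group datum
`BadLocalGroupDatum G Π^tp_{X̲̲}` is INHABITED over every [EtTh] §1 setting with «`Π^tp_X` tempered, first countable»,
`K = K̈`, a double-underline curve and an identification `ι`. [cite: Mochizuki2012, I Ex 3.2 (i)(v) pp.70-72] -/
theorem nonempty_ofDoubleUnderline_of_isTempered (hX : IsTempered D.PiTemp) [FirstCountableTopology D.PiTemp]
    (hS : D.Sec2Hyps) (C : E.DoubleUnderline l) (ι : ↥D.GK ≃ₜ* G) : Nonempty (BadLocalGroupDatum G ↥C.Huu) := by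
  obtain ⟨T, -, -⟩ := exists_badLocalGroupDatum_of_isTempered hX hS C ι
  exact ⟨T⟩

/-! ### At the Tate datum of record `ThetaSetting.modelχq p i j`: no binder at all -/

section Model

open Literature.AnabelianGeometry.EtaleTheta.SettingModel

variable (p) (i j : ℤ) (hj : Even j)

/-- **Law (b) at `modelχq`, hypothesis-free**: for every étale theta datum `E` over the stage-2 Tate model, every
double-underline curve `C` and every identification `ι`, the augmentation `Π^tp_{X̲̲} → G` is an OPEN map
(`Π^tp_X(modelχq)` is tempered and Galois-countable: `isTempered_piTemp_modelχq`, `secondCountableTopology_piTemp_modelχq`).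
[cite: MochizukiSemiAnbd2006, §6 p.69] -/
theorem isOpenMap_augOfDoubleUnderline_modelχq {E : (ThetaSetting.modelχq p i j hj).EtaleThetaData}
    (ι : ↥(ThetaSetting.modelχq p i j hj).GK ≃ₜ* G) (C : E.DoubleUnderline l) :
    IsOpenMap (augOfDoubleUnderline ι C) := by
  haveI := secondCountableTopology_piTemp_modelχq p i j hj
  exact isOpenMap_augOfDoubleUnderline_of_isTempered (isTempered_piTemp_modelχq p i j hj) ι C

/-- **Law (c) at `modelχq`, hypothesis-free**: `aug(Π^tp_{Ÿ̲̲}) = ⊤`, with `Π^tp_{Ÿ̲̲}` the OPEN subgroup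
`Ydduu (modelχq_sec2Hyps …) C` (`K = K̈ = ℚ_p` at the model: `ThetaSetting.modelχq_sec2Hyps`).
[cite: MochizukiEtTh2009, Prop 2.2 (iii) p.37] -/
theorem map_augOfDoubleUnderline_Ydduu_modelχq {E : (ThetaSetting.modelχq p i j hj).EtaleThetaData}
    (ι : ↥(ThetaSetting.modelχq p i j hj).GK ≃ₜ* G) (C : E.DoubleUnderline l) :
    (Ydduu (ThetaSetting.modelχq_sec2Hyps p i j hj) C).toSubgroup.map (augOfDoubleUnderline ι C) = ⊤ :=
  map_augOfDoubleUnderline_Ydduu (ThetaSetting.modelχq_sec2Hyps p i j hj) ι C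

/-- **The [IUTchI] Ex. 3.2 group datum at the Tate datum of record, NO hypothesis binder**: over
`ThetaSetting.modelχq p i j hj`, for every étale theta datum `E`, every double-underline curve `C : E.DoubleUnderline l`
and every identification `ι : G_K ≃ₜ* G`, there is a `BadLocalGroupDatum G ↥C.Huu` with augmentation
`ι ∘ augGK|_{Π^tp_{X̲̲}}` and covering subgroup `Π^tp_{Ÿ̲̲}` — all three interface laws are theorems here.
[cite: Mochizuki2012, I Ex 3.2 (i)(v) pp.70-72] -/
theorem exists_badLocalGroupDatum_modelχq {E : (ThetaSetting.modelχq p i j hj).EtaleThetaData}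
    (C : E.DoubleUnderline l) (ι : ↥(ThetaSetting.modelχq p i j hj).GK ≃ₜ* G) :
    ∃ T : BadLocalGroupDatum G ↥C.Huu,
      T.aug = augOfDoubleUnderline ι C ∧ T.Y = Ydduu (ThetaSetting.modelχq_sec2Hyps p i j hj) C := by
  haveI := secondCountableTopology_piTemp_modelχq p i j hj
  exact exists_badLocalGroupDatum_of_isTempered (isTempered_piTemp_modelχq p i j hj)
    (ThetaSetting.modelχq_sec2Hyps p i j hj) C ι

/-- **Existence form at the Tate datum of record, NO hypothesis binder**: `BadLocalGroupDatum G Π^tp_{X̲̲}` is INHABITED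
over `ThetaSetting.modelχq p i j hj` for every `E`, `C`, `ι`. [cite: Mochizuki2012, I Ex 3.2 (i)(v) pp.70-72] -/
theorem nonempty_ofDoubleUnderline_modelχq {E : (ThetaSetting.modelχq p i j hj).EtaleThetaData}
    (C : E.DoubleUnderline l) (ι : ↥(ThetaSetting.modelχq p i j hj).GK ≃ₜ* G) :
    Nonempty (BadLocalGroupDatum G ↥C.Huu) := by
  obtain ⟨T, -, -⟩ := exists_badLocalGroupDatum_modelχq p i j hj C ι
  exact ⟨T⟩

/-- **The same at the model's OWN Galois group** (`ι := refl`, `G := G_K(modelχq)`): the [IUTchI] Ex. 3.2 group datum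
over `Gal`-side `G_K` itself is inhabited with no hypothesis and no identification parameter.
[cite: Mochizuki2012, I Ex 3.2 (i)(v) pp.70-72] -/
theorem nonempty_ofDoubleUnderline_modelχq_refl {E : (ThetaSetting.modelχq p i j hj).EtaleThetaData}
    (C : E.DoubleUnderline l) :
    Nonempty (BadLocalGroupDatum ↥(ThetaSetting.modelχq p i j hj).GK ↥C.Huu) :=
  nonempty_ofDoubleUnderline_modelχq p i j hj C (ContinuousMulEquiv.refl _)

end Model

end BadLocalGroupDatum

end Literature.IUT.HodgeTheaters

end
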